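import Mathlib.RingTheory.Algebraic.Integral
import Literature.NumberTheory.Transcendental.KZCalculusProofs
import Literature.NumberTheory.Transcendental.KZCubicalCalculus
import Literature.NumberTheory.Transcendental.KZSemialgebraicComplex
import Literature.NumberTheory.Transcendental.SemialgebraicLineDeriv

/-!
# `StokesGeneration` (stmt-KontsevichZagierPeriods-3586), line `fibrewise_stokes`, stub `stub_boxToCube` (rung 9f, X12)

AFFINE CUBIFICATION OF A CLOSED BOX WITH ALGEBRAIC CORNERS (one rule-(2) move). THEOREM D of the
line (closed-unit-cube representations with separated-variables rational integrands of value `0`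
are Kontsevich–Zagier relations) is phrased on the closed unit cube `[0,1]ᴺ`; to state its corollary
in KZ's native language for a BOX `Π [lᵢ, uᵢ]` with real algebraic corners `lᵢ < uᵢ` the lead needs the
one change of variables `x ↦ l + (u − l)·x` of the unit cube onto the box — the registered stub
`stub_boxToCube`, proved here: a representation `r` on the box is congruent modulo `KZ.relations`
to the cube representation `t` with integrand `(Π (uᵢ − lᵢ)) · r.integrand (l + (u − l)·x)`.

Proof. The chart `Φ x = (lᵢ + (uᵢ − lᵢ) xᵢ)ᵢ` is a `ℚ`-semialgebraic map on the cube (its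
coordinates are `const + const · Xᵢ` with REAL ALGEBRAIC constants,
`isSemialgebraicFunOn_const_of_isAlgebraic`), injective (`uᵢ − lᵢ ≠ 0`), maps the cube ONTO the box
(preimage point `((yᵢ − lᵢ)/(uᵢ − lᵢ))ᵢ`), and has the constant derivative
`Φ' = diag(uᵢ − lᵢ)` (`Matrix.toLin'` of a diagonal matrix) of determinant `Π (uᵢ − lᵢ) > 0`
(`LinearMap.det_toLin'`, `Matrix.det_diagonal`). The cube representation
`t = [[0,1]ᴺ, (Π (uᵢ − lᵢ)) · (r.integrand ∘ Φ)]` exists: its integrand is the product of an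
algebraic constant with the composite of a semialgebraic function and a semialgebraic map
(`IsSemialgebraicFunOn.comp_isSemialgebraicMapOn_holds`), and it is integrable by Mathlib's
`MeasureTheory.integrableOn_image_iff_integrableOn_abs_det_fderiv_smul` applied to `r.integrableOn`.
Then `[t] − [r] ∈ KZ.changeOfVariablesRel` verbatim (source `t`, target `r`,
`t.integrand x = r.integrand (Φ x) · |det Φ'|`), and `[r] − [t] = −([t] − [r]) ∈ relations`.
Pattern of `KZCubicalCalculus.lean` (`halfScaleCLM`, subdivision moves) and of
`TerasomaMultiplicationBetaCancellationStubAffineMove.lean` (dimension one); no definition is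
introduced (the chart and its derivative are written out).

References: M. Kontsevich, D. Zagier, *Periods* (2001), §1.2 rule (2).
-/

noncomputable section

set_option linter.dupNamespace false

namespace Summit.KontsevichZagierPeriods.KontsevichZagierPeriods.Cruxes.StokesGeneration.FibrewiseStokes

open MeasureTheory Set
open Literature.NumberTheory.Transcendental
open Literature.NumberTheory.Transcendental.KZ
open Literature.ModelTheory.ExponentialFields (IsSemialgebraic)
open MvPolynomial (aeval X C)

/-! ## The diagonal derivative `diag(dᵢ)` -/

/-- The diagonal continuous linear map `diag(dᵢ)` of `ℝᴺ` acts coordinatewise: `(diag d) v i = dᵢ vᵢ`.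
[folklore] -/
theorem boxAff_diag_apply {N : ℕ} (d v : Fin N → ℝ) (i : Fin N) :
    LinearMap.toContinuousLinearMap (Matrix.toLin' (Matrix.diagonal d)) v i = d i * v i := by
  simp only [LinearMap.coe_toContinuousLinearMap', Matrix.toLin'_apply, Matrix.mulVec_diagonal]

/-- The determinant of the diagonal map `diag(dᵢ)` is `Π dᵢ`. [folklore] -/
theorem boxAff_diag_det {N : ℕ} (d : Fin N → ℝ) :
    (LinearMap.toContinuousLinearMap (Matrix.toLin' (Matrix.diagonal d))).det = ∏ i, d i := by
  simp [LinearMap.det_toLin', Matrix.det_diagonal]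

/-! ## The affine chart `Φ x = l + (u − l)·x` of `ℝᴺ` -/

/-- The affine chart `x ↦ (lᵢ + (uᵢ − lᵢ) xᵢ)ᵢ` has derivative `diag(uᵢ − lᵢ)` everywhere. [folklore] -/
theorem boxAff_hasFDerivAt {N : ℕ} (l u x : Fin N → ℝ) :
    HasFDerivAt (fun y : Fin N → ℝ => fun i => l i + (u i - l i) * y i)
      (LinearMap.toContinuousLinearMap (Matrix.toLin' (Matrix.diagonal fun i => u i - l i))) x := by
  have h : (fun y : Fin N → ℝ => fun i => l i + (u i - l i) * y i) = fun y =>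
      (LinearMap.toContinuousLinearMap (Matrix.toLin' (Matrix.diagonal fun i => u i - l i))) y + l := by
    funext y
    funext i
    rw [Pi.add_apply, boxAff_diag_apply]
    ring
  rw [h]
  exact (ContinuousLinearMap.hasFDerivAt _).add_const l

/-- The affine chart is injective when `lᵢ < uᵢ` for all `i`. [folklore] -/
theorem boxAff_injective {N : ℕ} {l u : Fin N → ℝ} (hlu : ∀ i, l i < u i) :
    Function.Injective (fun y : Fin N → ℝ => fun i => l i + (u i - l i) * y i) := by
  intro x y hxy
  funext i
  have h : l i + (u i - l i) * x i = l i + (u i - l i) * y i := congrFun hxy i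
  exact mul_left_cancel₀ (sub_pos.mpr (hlu i)).ne' (add_left_cancel h)

/-- The affine chart maps the closed unit cube ONTO the closed box `Π [lᵢ, uᵢ]` (`lᵢ < uᵢ`; preimage
point `((yᵢ − lᵢ)/(uᵢ − lᵢ))ᵢ`). [folklore] -/
theorem boxAff_image_cube {N : ℕ} {l u : Fin N → ℝ} (hlu : ∀ i, l i < u i) :
    (fun y : Fin N → ℝ => fun i => l i + (u i - l i) * y i) ''
        Set.pi Set.univ (fun _ : Fin N => Set.Icc (0:ℝ) 1) =
      Set.pi Set.univ (fun i => Set.Icc (l i) (u i)) := by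
  ext y
  simp only [mem_image, mem_pi, mem_univ, true_implies, mem_Icc]
  constructor
  · rintro ⟨x, hx, rfl⟩ i
    obtain ⟨h0, h1⟩ := hx i
    have hd : 0 < u i - l i := sub_pos.mpr (hlu i)
    constructor <;> nlinarith
  · intro hy
    refine ⟨fun i => (y i - l i) / (u i - l i), fun i => ?_, ?_⟩
    · have hd : 0 < u i - l i := sub_pos.mpr (hlu i)
      obtain ⟨h0, h1⟩ := hy i
      exact ⟨div_nonneg (by linarith) hd.le, (div_le_one hd).mpr (by linarith)⟩
    · funext i
      have hd : u i - l i ≠ 0 := (sub_pos.mpr (hlu i)).ne'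
      field_simp
      ring

/-- The affine chart is a `ℚ`-semialgebraic map on any `ℚ`-semialgebraic set when the corners `l`, `u`
are real algebraic: each coordinate `lᵢ + (uᵢ − lᵢ)·Xᵢ` has real algebraic coefficients
(`isSemialgebraicFunOn_const_of_isAlgebraic`, closure under `+`, `·`). [folklore] -/
theorem boxAff_isSemialgebraicMapOn {N : ℕ} {σ : Set (Fin N → ℝ)} (hσ : IsSemialgebraic ℚ σ)
    {l u : Fin N → ℝ} (hl : ∀ i, IsAlgebraic ℚ (l i)) (hu : ∀ i, IsAlgebraic ℚ (u i)) :
    IsSemialgebraicMapOn ℚ σ (fun y : Fin N → ℝ => fun i => l i + (u i - l i) * y i) := by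
  refine IsSemialgebraicMapOn.of_forall hσ fun i => ?_
  have hcoord : IsSemialgebraicFunOn ℚ σ (fun y : Fin N → ℝ => y i) :=
    (isSemialgebraicFunOn_aeval hσ (X i : MvPolynomial (Fin N) ℚ)).congr fun y _ =>
      MvPolynomial.aeval_X _ _
  exact (isSemialgebraicFunOn_const_of_isAlgebraic hσ (hl i)).fun_add
    ((isSemialgebraicFunOn_const_of_isAlgebraic hσ ((hu i).sub (hl i))).fun_mul hcoord)

/-- The Jacobian constant `Π (uᵢ − lᵢ)` is real algebraic when the corners are. [folklore] -/
theorem boxAff_isAlgebraic_prod {N : ℕ} {l u : Fin N → ℝ} (hl : ∀ i, IsAlgebraic ℚ (l i))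
    (hu : ∀ i, IsAlgebraic ℚ (u i)) : IsAlgebraic ℚ (∏ i, (u i - l i)) :=
  Finset.prod_induction _ _ (fun _ _ ha hb => ha.mul hb) isAlgebraic_one
    fun i _ => (hu i).sub (hl i)

/-! ## The stub -/

/-- **Registered stub `stub_boxToCube` (rung 9f, X12): affine cubification of a closed box with
algebraic corners (one rule-(2) move).** A representation on the box `Π [lᵢ, uᵢ]` (`lᵢ < uᵢ` real
algebraic) is congruent modulo the Kontsevich–Zagier relations to the closed-unit-cube representation
with integrand `(Π (uᵢ − lᵢ))·h(l + (u − l)·x)` (the affine change of variables `x ↦ l + (u − l)x`,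
constant Jacobian `Π (uᵢ − lᵢ)`). [cite: KontsevichZagier2001, §1.2 rule (2)] -/
theorem stub_boxToCube :
    ∀ (N : ℕ) (l u : Fin N → ℝ) (r : IntegralRep N), (∀ i, IsAlgebraic ℚ (l i)) → (∀ i, IsAlgebraic ℚ (u i)) →
      (∀ i, l i < u i) → r.domain = Set.pi Set.univ (fun i => Set.Icc (l i) (u i)) →
      ∃ t : IntegralRep N, t.domain = Set.pi Set.univ (fun _ : Fin N => Set.Icc (0:ℝ) 1) ∧
        (∀ x ∈ Set.pi Set.univ (fun _ : Fin N => Set.Icc (0:ℝ) 1),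
          t.integrand x = (∏ i, (u i - l i)) * r.integrand (fun i => l i + (u i - l i) * x i)) ∧
        of r - of t ∈ relations := by
  intro N l u r hl hu hlu hdom
  -- the closed unit cube
  have hC : IsSemialgebraic ℚ (Set.pi Set.univ (fun _ : Fin N => Set.Icc (0:ℝ) 1)) := by
    rw [← cube_eq_pi]
    exact isSemialgebraic_cube
  have hCmeas : MeasurableSet (Set.pi Set.univ (fun _ : Fin N => Set.Icc (0:ℝ) 1)) :=
    MeasurableSet.univ_pi fun _ => measurableSet_Icc
  -- the chart: semialgebraic, injective, onto the box, derivative of determinant `Π (uᵢ − lᵢ) > 0`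
  have himage := boxAff_image_cube hlu
  have hdom' : r.domain = (fun y : Fin N → ℝ => fun i => l i + (u i - l i) * y i) ''
      Set.pi Set.univ (fun _ : Fin N => Set.Icc (0:ℝ) 1) := hdom.trans himage.symm
  have hmaps : MapsTo (fun y : Fin N → ℝ => fun i => l i + (u i - l i) * y i)
      (Set.pi Set.univ (fun _ : Fin N => Set.Icc (0:ℝ) 1)) r.domain := by
    rw [hdom']
    exact mapsTo_image _ _
  have hsa := boxAff_isSemialgebraicMapOn hC hl hu
  have hinj : InjOn (fun y : Fin N → ℝ => fun i => l i + (u i - l i) * y i)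
      (Set.pi Set.univ (fun _ : Fin N => Set.Icc (0:ℝ) 1)) := (boxAff_injective hlu).injOn
  have hdet : |(LinearMap.toContinuousLinearMap
      (Matrix.toLin' (Matrix.diagonal fun i => u i - l i))).det| = ∏ i, (u i - l i) := by
    rw [boxAff_diag_det]
    exact abs_of_pos (Finset.prod_pos fun i _ => sub_pos.mpr (hlu i))
  -- the cube integrand `(Π (uᵢ − lᵢ)) · (r.integrand ∘ Φ)`: semialgebraic and integrable
  have hcomp : IsSemialgebraicFunOn ℚ (Set.pi Set.univ (fun _ : Fin N => Set.Icc (0:ℝ) 1))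
      (r.integrand ∘ fun y : Fin N → ℝ => fun i => l i + (u i - l i) * y i) :=
    IsSemialgebraicFunOn.comp_isSemialgebraicMapOn_holds r.isSemialgebraicFunOn_integrand hsa hmaps
  have hg_sa : IsSemialgebraicFunOn ℚ (Set.pi Set.univ (fun _ : Fin N => Set.Icc (0:ℝ) 1))
      (fun x => (∏ i, (u i - l i)) * r.integrand (fun i => l i + (u i - l i) * x i)) :=
    (isSemialgebraicFunOn_const_of_isAlgebraic hC (boxAff_isAlgebraic_prod hl hu)).fun_mul hcomp
  have hg_int : IntegrableOn
      (fun x => (∏ i, (u i - l i)) * r.integrand (fun i => l i + (u i - l i) * x i))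
      (Set.pi Set.univ (fun _ : Fin N => Set.Icc (0:ℝ) 1)) := by
    have h := (integrableOn_image_iff_integrableOn_abs_det_fderiv_smul volume hCmeas
      (fun x _ => (boxAff_hasFDerivAt l u x).hasFDerivWithinAt) hinj r.integrand).mp
      (hdom' ▸ r.integrableOn)
    refine h.congr_fun (fun x _ => ?_) hCmeas
    simp only [smul_eq_mul, hdet]
  -- the cube representation
  let t : IntegralRep N :=
    ⟨Set.pi Set.univ (fun _ : Fin N => Set.Icc (0:ℝ) 1),
      fun x => (∏ i, (u i - l i)) * r.integrand (fun i => l i + (u i - l i) * x i), hC, hg_sa, hg_int⟩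
  refine ⟨t, rfl, fun x _ => rfl, ?_⟩
  -- one change-of-variables move with SOURCE `t` and TARGET `r`
  have hmove : of t - of r ∈ relations := by
    refine changeOfVariablesRel_subset_relations
      ⟨N, t, r, fun y : Fin N → ℝ => fun i => l i + (u i - l i) * y i,
        fun _ => LinearMap.toContinuousLinearMap (Matrix.toLin' (Matrix.diagonal fun i => u i - l i)),
        hsa, fun x _ => (boxAff_hasFDerivAt l u x).hasFDerivWithinAt, hinj, hdom', fun x _ => ?_, rfl⟩
    show (∏ i, (u i - l i)) * r.integrand (fun i => l i + (u i - l i) * x i) =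
      r.integrand (fun i => l i + (u i - l i) * x i) * |(LinearMap.toContinuousLinearMap
        (Matrix.toLin' (Matrix.diagonal fun i => u i - l i))).det|
    rw [hdet, mul_comm]
  rw [← neg_sub]
  exact relations.neg_mem hmove

end Summit.KontsevichZagierPeriods.KontsevichZagierPeriods.Cruxes.StokesGeneration.FibrewiseStokes
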